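import Summits.AtomisticToContinuum.Crystallization.Theses.IsometryAtoms
import Literature.MathematicalPhysics.StatisticalMechanics.BarlowStacking
import Literature.MathematicalPhysics.StatisticalMechanics.HcpHomogeneous
import Summits.AtomisticToContinuum.Crystallization.Theorems.PalmUnimodularRigidityMinimiserShellsMeckePricing
import Summits.AtomisticToContinuum.Crystallization.Theorems.IsometryAtomsMinimisingLawsHaveAtomsHcpPatchRigid
import Summits.AtomisticToContinuum.Crystallization.Theorems.IsometryAtomsMinimisingLawsHaveAtomsHcpStepConnected
import Summits.AtomisticToContinuum.Crystallization.Theorems.IsometryAtomsMinimisingLawsHaveAtomsHcpCovering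
import Summits.AtomisticToContinuum.Crystallization.Theorems.IsometryAtomsMinimisingLawsHaveAtomsLocallyRigidOf

/-!
# Skeleton of line `IdeatorOneSketch` (idea `strict-calibration-exactness`) for the crux
# `IsometryAtoms.MinimisingLawsHaveAtoms` (stmt-AtomisticToContinuum-15776) — lead's reshaped copy

EXACT COMPLEMENTARY SLACKNESS in the Palm LP. A STRICT Mecke calibration at the relaxed-hcp
template (bounded finite-hop bond transfer `t`, slack `σ := h + div t − e* ≥ 0` on every rooted
hard-core configuration, `σ = 0` only when the root's closed `R₀`-ball is EXACTLY that of a rooted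
copy of `hcpStacking a h`) makes every minimising point-stationary law almost surely exact at
radius `R₀` (`firstLemma_holds`, PROVED from the landed Mecke pricing
`MeckePricing.stub_meckePricing_unfolded`); "root a.s. exact ⇒ every point a.s. exact" (the landed
`PalmUnimodularRigidity.ae_forall_map_sub_of_ae`) and the exact local theorem for relaxed hcp turn
this into "a.s. the configuration IS a rooted copy of hcp", i.e. the crux with full mass.

Stubs S2–S5 LANDED in wave 1 (2026-08-17; p166933, p166344, p166263, p166523, namespace
`…Theorems.IsometryAtomsMinimisingLawsHaveAtoms`) and are now USED BY NAME; the only remaining `sorry`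
is the content stub S6 `stub_strictCalibrationHcp`.

Stub list (def-free signatures):
* `stub_hcpPatchRigid` (LANDED p166933) — linear patch rigidity of relaxed hcp at radius `23a/20` (the setwise
  stabiliser of the 13-point patch `{0} ∪ first shell` inside the linear isometries is the site
  group `D_3h`, every element of which preserves `hcpStacking a h`), for `h/a ∈ [39/50, 17/20]`;
* `stub_hcpStepConnected` (LANDED p166344) — every point of hcp is reached from `0` by steps of length `≤ 21a/20`
  inside hcp;
* `stub_hcpCovering` (LANDED p166263) — every point of space is within `11a/5` of hcp;
* `stub_locallyRigid_of` (LANDED p166523) — GENERIC exact local theorem: homogeneity + linear patch rigidity at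
  radius `R₁` + step-connectivity at step `ρ` + covering at radius `R₀ ≥ R₁ + ρ` ⇒
  `LocallyRigid R₀ Y` (induction along the step graph);
* `stub_strictCalibrationHcp` — THE CONTENT: for every hard core `δ > 0` a strict finite-hop Mecke
  calibration at some relaxed hcp template in the box, exact at radius `11a/5`.
Proved here: `firstLemma_holds` (sketch), `secondLemma_holds`, `locallyRigid_hcp`,
`strictCalibration_hcp` (unfolding), and the composition `MinimisingLawsHaveAtoms_of` concluding
the crux BY NAME.
-/

noncomputable section

open MeasureTheory
open Literature.Probability.Process (IsPointStationaryLaw IsRootedHardCore map_sub_count_restrict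
  count_restrict_singleton_ne_zero_iff)
open Literature.MathematicalPhysics.StatisticalMechanics (lennardJones rootEnergy PeriodicConfiguration
  hcpStacking hcpStacking_homogeneous barlowPos haggLabel_zero)

namespace Summit.AtomisticToContinuum.Crystallization.Cruxes.MinimisingLawsHaveAtoms.IdeatorOne

/-- Euclidean 3-space. -/
abbrev E3 := EuclideanSpace ℝ (Fin 3)

/-- `e* = ⨅` over periodic configurations of the LJ energy per particle (genuine infimum:
`crysPeriodicBddBelow_proof`). -/
def eStar : ℝ := ⨅ Q : PeriodicConfiguration 3, Q.energyPerParticle lennardJones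

/-- Divergence at the root of a bond transfer `t` ("sent minus received"), the Mecke-exact part of a
calibration: `E_P[divT t] = 0` for every point-stationary hard-core law (landed:
`MeckePricing.transfer_package`). -/
def divT (t : Measure E3 → E3 → ℝ) (μ : Measure E3) : ℝ :=
  ∫ y, (t μ y - t (Measure.map (fun z => z - y) μ) (-y)) ∂μ

/-- The rooted isometry class of a template `Y` — literally the event of the crux. -/
def rootedClass (Y : Set E3) : Set (Measure E3) :=
  {μ | ∃ A : E3 →ₗᵢ[ℝ] E3, ∃ q ∈ Y,
    μ = (Measure.count : Measure E3).restrict ((fun s => A (s - q)) '' Y)}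

/-- EXACT environment of radius `R₀`: the root's closed `R₀`-ball coincides with that of a rooted
isometric copy of `Y` (no tolerance). -/
def ExactEnvAt (R₀ : ℝ) (Y : Set E3) (μ : Measure E3) : Prop :=
  ∃ ν ∈ rootedClass Y,
    μ.restrict (Metric.closedBall (0 : E3) R₀) = ν.restrict (Metric.closedBall (0 : E3) R₀)

/-- **Strict Mecke calibration** at template `Y`, hard core `δ`, exactness radius `R₀`: a jointly
measurable, bounded, finite-hop bond transfer `t` (the landed pricing hypotheses verbatim) such that
(i) `e* ≤ h + div t` on EVERY rooted `δ`-hard-core configuration (slack `σ ≥ 0`; weak duality) and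
(ii) STRICTNESS: `σ = 0` forces the exact `Y`-environment of radius `R₀`. -/
def StrictCalibration (δ R₀ : ℝ) (Y : Set E3) : Prop :=
  ∃ (R M : ℝ) (t : Measure E3 → E3 → ℝ), Measurable (Function.uncurry t) ∧ (∀ μ y, |t μ y| ≤ M) ∧
    (∀ μ y, R < ‖y‖ → t μ y = 0) ∧
    (∀ μ : Measure E3, IsRootedHardCore δ μ → eStar ≤ rootEnergy lennardJones μ + divT t μ) ∧
    (∀ μ : Measure E3, IsRootedHardCore δ μ →
      rootEnergy lennardJones μ + divT t μ = eStar → ExactEnvAt R₀ Y μ)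

/-- **First lemma** (soft): a strict calibration makes every minimising point-stationary
`δ`-hard-core probability law almost surely exact at radius `R₀`. -/
def FirstLemma : Prop :=
  ∀ δ R₀ : ℝ, 0 < δ → ∀ Y : Set E3, StrictCalibration δ R₀ Y →
    ∀ P : Measure (Measure E3), IsProbabilityMeasure P → (∀ᵐ μ ∂P, IsRootedHardCore δ μ) →
      IsPointStationaryLaw P → (∫ μ, rootEnergy lennardJones μ ∂P) ≤ eStar →
      ∀ᵐ μ ∂P, ExactEnvAt R₀ Y μ

/-- **The first lemma HOLDS** (ideator's proof, kept verbatim) — corollary of the landed Mecke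
pricing theorem `MeckePricing.stub_meckePricing_unfolded`, priced with the events
`G_n := {h + div t < e* + 1/(n+1)}`. -/
theorem firstLemma_holds : FirstLemma := by
  intro δ R₀ hδ Y hcal P hP hhc hst hE
  obtain ⟨R, M, t, ht, hM, hR, hweak, hstrict⟩ := hcal
  have hmean : Summit.AtomisticToContinuum.Crystallization.Theorems.MinimiserShells.Negative.LoadBearing.meanRootEnergy
      P ≤ eStar := hE
  have key : ∀ n : ℕ, ∀ᵐ μ ∂P, rootEnergy lennardJones μ + divT t μ < eStar + 1 / ((n : ℝ) + 1) := by
    intro n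
    have hc₀ : (0 : ℝ) ≤ 1 / ((n : ℝ) + 1) := by positivity
    have hpos : (0 : ℝ) < 1 / ((n : ℝ) + 1) := by positivity
    have hpr :=
      Summit.AtomisticToContinuum.Crystallization.Theorems.PalmUnimodularRigidityMinimiserShells.MeckePricing.stub_meckePricing_unfolded
        δ hδ P hP hhc hst R M t ⟨ht, hM, hR⟩
        (fun μ => rootEnergy lennardJones μ + divT t μ < eStar + 1 / ((n : ℝ) + 1)) eStar (1 / ((n : ℝ) + 1)) hc₀
        (fun μ hμ => ⟨hweak μ hμ, fun hG => not_lt.1 hG⟩)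
    have hprod : 1 / ((n : ℝ) + 1) *
        (P {μ | ¬ (rootEnergy lennardJones μ + divT t μ < eStar + 1 / ((n : ℝ) + 1))}).toReal ≤ 0 := by
      linarith
    have hnn : 0 ≤ (P {μ | ¬ (rootEnergy lennardJones μ + divT t μ < eStar + 1 / ((n : ℝ) + 1))}).toReal :=
      ENNReal.toReal_nonneg
    have hzero : (P {μ | ¬ (rootEnergy lennardJones μ + divT t μ < eStar + 1 / ((n : ℝ) + 1))}).toReal = 0 :=
      le_antisymm (by nlinarith [mul_nonneg hpos.le hnn]) hnn
    have hnull : P {μ | ¬ (rootEnergy lennardJones μ + divT t μ < eStar + 1 / ((n : ℝ) + 1))} = 0 := by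
      rcases (ENNReal.toReal_eq_zero_iff _).1 hzero with h0 | htop
      · exact h0
      · exact absurd htop (measure_ne_top P _)
    rw [ae_iff]
    exact hnull
  have hall : ∀ᵐ μ ∂P, ∀ n : ℕ, rootEnergy lennardJones μ + divT t μ < eStar + 1 / ((n : ℝ) + 1) :=
    ae_all_iff.2 key
  filter_upwards [hall, hhc] with μ hμ hμhc
  have hle : rootEnergy lennardJones μ + divT t μ ≤ eStar := by
    refine le_of_forall_pos_lt_add fun ε hε => ?_
    obtain ⟨n, hn⟩ := exists_nat_one_div_lt hε
    calc rootEnergy lennardJones μ + divT t μ < eStar + 1 / ((n : ℝ) + 1) := hμ n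
      _ < eStar + ε := by linarith
  exact hstrict μ hμhc (le_antisymm hle (hweak μ hμhc))

/-- **Exact local theorem** (deterministic, potential-free): a point set containing `0` all of
whose points have exact `Y`-environments of radius `R₀` IS a rooted isometric copy of `Y`. -/
def LocallyRigid (R₀ : ℝ) (Y : Set E3) : Prop :=
  ∀ S : Set E3, (0 : E3) ∈ S →
    (∀ x ∈ S, ExactEnvAt R₀ Y ((Measure.count : Measure E3).restrict ((fun s => s - x) '' S))) →
    (Measure.count : Measure E3).restrict S ∈ rootedClass Y

/-- **Second lemma** (law form of the exact local theorem): "root a.s. exact ⇒ every point a.s.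
exact" and `LocallyRigid` give: a.s. the configuration is a rooted copy of `Y`. -/
def SecondLemma : Prop :=
  ∀ δ R₀ : ℝ, 0 < δ → ∀ Y : Set E3, LocallyRigid R₀ Y →
    ∀ P : Measure (Measure E3), IsProbabilityMeasure P → (∀ᵐ μ ∂P, IsRootedHardCore δ μ) →
      IsPointStationaryLaw P → (∀ᵐ μ ∂P, ExactEnvAt R₀ Y μ) → ∀ᵐ μ ∂P, μ ∈ rootedClass Y

/-! ## The remaining registered stub (def-free signature; the only `sorry` of the file) -/

/-- STUB S6 (THE CONTENT of the line; contains the optimality of relaxed hcp). **Strict Mecke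
calibration at the relaxed-hcp template**: for every hard core `δ > 0` there are box parameters
`a > 0`, `h/a ∈ [39/50, 17/20]` and a jointly measurable, bounded, finite-hop bond transfer `t`
with (i) weak duality `e* ≤ h(μ) + div t(μ)` on every rooted `δ`-hard-core configuration and
(ii) strictness: equality forces the root's closed `11a/5`-ball to be exactly that of a rooted
isometric copy of `hcpStacking a h`. (For `δ` so large that no `δ`-hard-core configuration reaches
`e*`, `t = 0` works and (ii) is vacuous; the content sits at `δ ≤ 1/3`.) -/
theorem stub_strictCalibrationHcp : ∀ δ : ℝ, 0 < δ → ∃ a h : ℝ, 0 < a ∧ 39 / 50 * a ≤ h ∧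
    h ≤ 17 / 20 * a ∧
    ∃ (R M : ℝ) (t : Measure (EuclideanSpace ℝ (Fin 3)) → EuclideanSpace ℝ (Fin 3) → ℝ),
      Measurable (Function.uncurry t) ∧ (∀ μ y, |t μ y| ≤ M) ∧ (∀ μ y, R < ‖y‖ → t μ y = 0) ∧
      (∀ μ : Measure (EuclideanSpace ℝ (Fin 3)), IsRootedHardCore δ μ →
        (⨅ Q : PeriodicConfiguration 3, Q.energyPerParticle lennardJones) ≤
          rootEnergy lennardJones μ +
            ∫ y, (t μ y - t (Measure.map (fun z => z - y) μ) (-y)) ∂μ) ∧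
      (∀ μ : Measure (EuclideanSpace ℝ (Fin 3)), IsRootedHardCore δ μ →
        rootEnergy lennardJones μ +
            ∫ y, (t μ y - t (Measure.map (fun z => z - y) μ) (-y)) ∂μ =
          (⨅ Q : PeriodicConfiguration 3, Q.energyPerParticle lennardJones) →
        ∃ ν ∈ {μ : Measure (EuclideanSpace ℝ (Fin 3)) |
            ∃ A : EuclideanSpace ℝ (Fin 3) →ₗᵢ[ℝ] EuclideanSpace ℝ (Fin 3),
              ∃ q ∈ hcpStacking a h,
                μ = (Measure.count : Measure (EuclideanSpace ℝ (Fin 3))).restrict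
                  ((fun s => A (s - q)) '' hcpStacking a h)},
          μ.restrict (Metric.closedBall (0 : EuclideanSpace ℝ (Fin 3)) (11 / 5 * a)) =
            ν.restrict (Metric.closedBall (0 : EuclideanSpace ℝ (Fin 3)) (11 / 5 * a))) := by
  sorry

/-! ## Proved glue -/

/-- **The second lemma HOLDS**: a.s. hard-core configurations are locally finite
(`count_restrict_floorNorm_preimage_lt_top`), so "everything shows at the root"
(`ae_forall_map_sub_of_ae`) moves a.s.-exactness of the root to every point; re-rooting a counting
measure is the counting measure of the translate (`map_sub_count_restrict`), and `LocallyRigid`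
concludes. -/
theorem secondLemma_holds : SecondLemma := by
  intro δ R₀ hδ Y hrig P hP hhc hst hex
  have hlf : ∀ᵐ μ ∂P, ∀ n : ℕ, μ ((fun z : E3 => ⌊‖z‖⌋₊) ⁻¹' {n}) < ⊤ := by
    filter_upwards [hhc] with μ hμ
    obtain ⟨S, -, hsep, rfl⟩ := hμ
    exact fun n =>
      Summit.AtomisticToContinuum.Crystallization.Theorems.PalmUnimodularRigidity.count_restrict_floorNorm_preimage_lt_top
        hδ hsep n
  have hall :=
    Summit.AtomisticToContinuum.Crystallization.Theorems.PalmUnimodularRigidity.ae_forall_map_sub_of_ae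
      hst hlf hex
  filter_upwards [hall, hhc] with μ hμ hμhc
  obtain ⟨S, h0, hsep, rfl⟩ := hμhc
  refine hrig S h0 fun x hx => ?_
  have hx' : (Measure.count : Measure E3).restrict S {x} ≠ 0 :=
    (count_restrict_singleton_ne_zero_iff S x).2 hx
  have h1 := hμ x hx'
  rwa [map_sub_count_restrict] at h1

/-- The origin is a point of every Barlow hcp stacking. -/
theorem zero_mem_hcpStacking (a h : ℝ) : (0 : E3) ∈ hcpStacking a h :=
  ⟨0, 0, 0, by simp [barlowPos]⟩

/-- **Local rigidity of relaxed hcp at radius `11a/5`** on the box — the EXACT LOCAL THEOREM for relaxed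
hcp — from the landed stubs S2–S5 (wave 1) and the landed homogeneity of hcp. -/
theorem locallyRigid_hcp (a h : ℝ) (ha : 0 < a) (hh₁ : 39 / 50 * a ≤ h) (hh₂ : h ≤ 17 / 20 * a) :
    LocallyRigid (11 / 5 * a) (hcpStacking a h) := by
  intro S h0 hS
  exact Summit.AtomisticToContinuum.Crystallization.Theorems.IsometryAtomsMinimisingLawsHaveAtoms.stub_locallyRigid_of
    (hcpStacking a h) (11 / 5 * a) (23 / 20 * a) (21 / 20 * a)
    (by positivity) (by positivity) (by linarith) (zero_mem_hcpStacking a h)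
    (fun p hp => hcpStacking_homogeneous a h hp)
    (Summit.AtomisticToContinuum.Crystallization.Theorems.IsometryAtomsMinimisingLawsHaveAtoms.stub_hcpPatchRigid
      a h ha hh₁ hh₂)
    (Summit.AtomisticToContinuum.Crystallization.Theorems.IsometryAtomsMinimisingLawsHaveAtoms.stub_hcpStepConnected
      a h ha hh₁ hh₂)
    (Summit.AtomisticToContinuum.Crystallization.Theorems.IsometryAtomsMinimisingLawsHaveAtoms.stub_hcpCovering
      a h ha hh₁ hh₂) S h0 hS

/-- **Strict calibration at the hcp template** on the box, exactness radius `11a/5` — the content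
stub, refolded into the line's vocabulary. -/
theorem strictCalibration_hcp (δ : ℝ) (hδ : 0 < δ) :
    ∃ a h : ℝ, 0 < a ∧ 39 / 50 * a ≤ h ∧ h ≤ 17 / 20 * a ∧
      StrictCalibration δ (11 / 5 * a) (hcpStacking a h) := by
  obtain ⟨a, h, ha, hh₁, hh₂, R, M, t, ht, hM, hR, hweak, hstrict⟩ := stub_strictCalibrationHcp δ hδ
  exact ⟨a, h, ha, hh₁, hh₂, R, M, t, ht, hM, hR, hweak, hstrict⟩

/-- **The line concludes the crux BY NAME.** For each hard core `δ`: the strict calibration at a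
relaxed hcp template (S6) makes a minimising law a.s. exact at radius `11a/5` (first lemma); local
rigidity of hcp at that radius (S2–S5) and the second lemma make it a.s. a rooted copy of
`hcpStacking a h`; so that rooted isometry class has (outer) measure `1 > 0`. -/
theorem MinimisingLawsHaveAtoms_of :
    Summit.AtomisticToContinuum.Crystallization.Theses.IsometryAtoms.MinimisingLawsHaveAtoms := by
  intro δ hδ P hP hhc hst hE
  obtain ⟨a, h, ha, hh₁, hh₂, hc⟩ := strictCalibration_hcp δ hδ
  have hr : LocallyRigid (11 / 5 * a) (hcpStacking a h) := locallyRigid_hcp a h ha hh₁ hh₂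
  refine ⟨hcpStacking a h, ?_⟩
  have hae : ∀ᵐ μ ∂P, μ ∈ rootedClass (hcpStacking a h) :=
    secondLemma_holds δ _ hδ _ hr P hP hhc hst (firstLemma_holds δ _ hδ _ hc P hP hhc hst hE)
  change 0 < P (rootedClass (hcpStacking a h))
  have h0 : P (rootedClass (hcpStacking a h))ᶜ = 0 := by
    rw [ae_iff] at hae
    simpa [Set.compl_def] using hae
  have h1' : (1 : ENNReal) ≤ P (rootedClass (hcpStacking a h)) := by
    calc (1 : ENNReal) = P Set.univ := measure_univ.symm
      _ = P (rootedClass (hcpStacking a h) ∪ (rootedClass (hcpStacking a h))ᶜ) := by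
          rw [Set.union_compl_self]
      _ ≤ P (rootedClass (hcpStacking a h)) + P (rootedClass (hcpStacking a h))ᶜ :=
          measure_union_le _ _
      _ = P (rootedClass (hcpStacking a h)) := by rw [h0, add_zero]
  exact lt_of_lt_of_le one_pos h1'

end Summit.AtomisticToContinuum.Crystallization.Cruxes.MinimisingLawsHaveAtoms.IdeatorOne

end
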